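import Summits.Ventures.Crystal3D.TopCut.TammesCertDefs2
import Summits.Ventures.Crystal3D.TopCut.TammesCertExpandD7bA
import Summits.Ventures.Crystal3D.TopCut.TammesCertExpandD7bB
import Summits.Ventures.Crystal3D.TopCut.TammesCertExpandD7bC
import Summits.Ventures.Crystal3D.TopCut.TammesCertExpandD7bD
import HarnessLib

/-!
# `T13(arccos(257/500))` in the kernel: no 13 points of `S²` pairwise `≥ 59.0694°` apart

The assembly of the Bachoc–Vallentin three-point certificate D7b (`n = 3`, `d = N = 7`, `c₁ = 257/500`): all
expansion data are valid (`certD7b_polys`, from the kernel checks of `TammesCertExpandD7b{A,B,C,D}` through the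
chunk-composition lemmas `ChunkSem`/`chunkSem_trans`/`FChunkSem` of `TammesCertDefs`) and therefore, by
`card_le_12_of_cert3` (`TammesCertDefs`, resting on `BachocVallentin.card_le_of_certificate3_int` of
`ThreePointKernelDimThree`), **every finite set of unit vectors of `ℝ³` with pairwise inner products
`≤ 257/500` has at most `12` elements** (`sphereCode_card_le_twelve_257_500`) — the Tammes-type top cut
`T13(59.0694°)` with STANDARD axioms (`decide`, not `native_decide`). Consumer: the sticky-sphere
crystallization programme (`Summits/Ventures/Crystal3D/Bulk/SphereCodeCut.lean`: the statement is
`SphereCodeBoundInner (257/500)` and, via the proved polar contraction, yields the cut `NoHole 0.5419`,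
`ρ* < 57.187°`, discharging the census tiers S-c and S-d). Tree form of the cell `pub-crystal3d`'s single file
`TammesKernelD7b.lean` (seat p2, farm rc 0 in 656 s; split by seat typer-bulk).

## References
* C. Bachoc, F. Vallentin, J. Amer. Math. Soc. 21 (2008) 909–924, Theorem 4.2, §5. [`BachocVallentin2007`]
-/

noncomputable section

namespace Summit.Ventures.Crystal3D.TopCut

open Literature.Geometry.DiscreteGeometry Literature.Geometry.DiscreteGeometry.PolyCert Literature.Geometry.DiscreteGeometry.PolyCert.SPoly

open Literature.Geometry.DiscreteGeometry Literature.Geometry.DiscreteGeometry.PolyCert Literature.Geometry.DiscreteGeometry.PolyCert.SPoly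
open PolyCert.SPoly TammesD7bCert

set_option maxRecDepth 100000 in
set_option maxHeartbeats 0 in
/-- All expansion data of the certificate D7b are valid. [folklore] -/
theorem certD7b_polys : PolysOK3 (Cert3.mk (257) (500) 7 40 28 34 certA (4777328529809) (-401464252043) (33737170191) [FBlk.mk 0 certFws0, FBlk.mk 1 certFws1, FBlk.mk 2 certFws2, FBlk.mk 3 certFws3, FBlk.mk 4 certFws4, FBlk.mk 5 certFws5, FBlk.mk 6 certFws6, FBlk.mk 7 certFws7] c0 c01) (CertPolys.mk (ofFlat fFP_0 ++ ofFlat fFP_1 ++ ofFlat fFP_2 ++ ofFlat fFP_3) (ofFlat fR_r_0 ++ ofFlat fR_r_1 ++ ofFlat fR_r_2 ++ ofFlat fR_r_3 ++ ofFlat fR_r_4 ++ ofFlat fR_r_5 ++ ofFlat fR_r_6) (ofFlat fR_ru_0 ++ ofFlat fR_ru_1 ++ ofFlat fR_ru_2 ++ ofFlat fR_ru_3 ++ ofFlat fR_ru_4) (permBAC (ofFlat fR_ru_0 ++ ofFlat fR_ru_1 ++ ofFlat fR_ru_2 ++ ofFlat fR_ru_3 ++ ofFlat fR_ru_4)) (permCBA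 (ofFlat fR_ru_0 ++ ofFlat fR_ru_1 ++ ofFlat fR_ru_2 ++ ofFlat fR_ru_3 ++ ofFlat fR_ru_4)) (ofFlat fR_r4_0 ++ ofFlat fR_r4_1 ++ ofFlat fR_r4_2) (ofFlat fR_q_0) (ofFlat fR_q1_0)) where
  hF := by
    have f1 : FChunkSem [] [FBlk.mk 0 certFws0, FBlk.mk 1 certFws1, FBlk.mk 2 certFws2] _ := fChunkSem_of_ok _ _ _ certD7b_F_c1
    have f2 : FChunkSem [] ([FBlk.mk 0 certFws0, FBlk.mk 1 certFws1, FBlk.mk 2 certFws2] ++ [FBlk.mk 3 certFws3, FBlk.mk 4 certFws4, FBlk.mk 5 certFws5]) _ := fChunkSem_trans _ _ _ _ _ f1 (fChunkSem_of_ok _ _ _ certD7b_F_c2)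
    have f3 : FChunkSem [] (([FBlk.mk 0 certFws0, FBlk.mk 1 certFws1, FBlk.mk 2 certFws2] ++ [FBlk.mk 3 certFws3, FBlk.mk 4 certFws4, FBlk.mk 5 certFws5]) ++ [FBlk.mk 6 certFws6, FBlk.mk 7 certFws7]) _ := fChunkSem_trans _ _ _ _ _ f2 (fChunkSem_of_ok _ _ _ certD7b_F_c3)
    exact fexpValid3_of_fChunkSem' [FBlk.mk 0 certFws0, FBlk.mk 1 certFws1, FBlk.mk 2 certFws2, FBlk.mk 3 certFws3, FBlk.mk 4 certFws4, FBlk.mk 5 certFws5, FBlk.mk 6 certFws6, FBlk.mk 7 certFws7] (([FBlk.mk 0 certFws0, FBlk.mk 1 certFws1, FBlk.mk 2 certFws2] ++ [FBlk.mk 3 certFws3, FBlk.mk 4 certFws4, FBlk.mk 5 certFws5]) ++ [FBlk.mk 6 certFws6, FBlk.mk 7 certFws7]) _ (by rfl) f3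
  hr := by
    have s1 : ChunkSem (GramBlk.mk z_r L_r) 0 15 [] _ := chunkSem_of_ok _ _ _ _ _ certD7b_r_c1
    have s2 : ChunkSem (GramBlk.mk z_r L_r) 0 30 [] _ := chunkSem_trans (GramBlk.mk z_r L_r) 0 15 15 _ _ _ s1 (chunkSem_of_ok _ _ _ _ _ certD7b_r_c2)
    have s3 : ChunkSem (GramBlk.mk z_r L_r) 0 45 [] _ := chunkSem_trans (GramBlk.mk z_r L_r) 0 30 15 _ _ _ s2 (chunkSem_of_ok _ _ _ _ _ certD7b_r_c3)
    have s4 : ChunkSem (GramBlk.mk z_r L_r) 0 60 [] _ := chunkSem_trans (GramBlk.mk z_r L_r) 0 45 15 _ _ _ s3 (chunkSem_of_ok _ _ _ _ _ certD7b_r_c4)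
    have s5 : ChunkSem (GramBlk.mk z_r L_r) 0 75 [] _ := chunkSem_trans (GramBlk.mk z_r L_r) 0 60 15 _ _ _ s4 (chunkSem_of_ok _ _ _ _ _ certD7b_r_c5)
    have s6 : ChunkSem (GramBlk.mk z_r L_r) 0 90 [] _ := chunkSem_trans (GramBlk.mk z_r L_r) 0 75 15 _ _ _ s5 (chunkSem_of_ok _ _ _ _ _ certD7b_r_c6)
    have s7 : ChunkSem (GramBlk.mk z_r L_r) 0 105 [] _ := chunkSem_trans (GramBlk.mk z_r L_r) 0 90 15 _ _ _ s6 (chunkSem_of_ok _ _ _ _ _ certD7b_r_c7)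
    have s8 : ChunkSem (GramBlk.mk z_r L_r) 0 120 [] _ := chunkSem_trans (GramBlk.mk z_r L_r) 0 105 15 _ _ _ s7 (chunkSem_of_ok _ _ _ _ _ certD7b_r_c8)
    exact boxNonneg_of_chunkSem' (GramBlk.mk z_r L_r) _ 120 (by decide) (lenOK_of_chunkOK _ _ _ _ _ certD7b_r_c1) s8
  hu := by
    have s1 : ChunkSem (GramBlk.mk z_ru L_ru) 0 15 [] _ := chunkSem_of_ok _ _ _ _ _ certD7b_ru_c1
    have s2 : ChunkSem (GramBlk.mk z_ru L_ru) 0 30 [] _ := chunkSem_trans (GramBlk.mk z_ru L_ru) 0 15 15 _ _ _ s1 (chunkSem_of_ok _ _ _ _ _ certD7b_ru_c2)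
    have s3 : ChunkSem (GramBlk.mk z_ru L_ru) 0 45 [] _ := chunkSem_trans (GramBlk.mk z_ru L_ru) 0 30 15 _ _ _ s2 (chunkSem_of_ok _ _ _ _ _ certD7b_ru_c3)
    have s4 : ChunkSem (GramBlk.mk z_ru L_ru) 0 60 [] _ := chunkSem_trans (GramBlk.mk z_ru L_ru) 0 45 15 _ _ _ s3 (chunkSem_of_ok _ _ _ _ _ certD7b_ru_c4)
    have s5 : ChunkSem (GramBlk.mk z_ru L_ru) 0 75 [] _ := chunkSem_trans (GramBlk.mk z_ru L_ru) 0 60 15 _ _ _ s4 (chunkSem_of_ok _ _ _ _ _ certD7b_ru_c5)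
    have s6 : ChunkSem (GramBlk.mk z_ru L_ru) 0 84 [] _ := chunkSem_trans (GramBlk.mk z_ru L_ru) 0 75 9 _ _ _ s5 (chunkSem_of_ok _ _ _ _ _ certD7b_ru_c6)
    exact boxNonneg_of_chunkSem' (GramBlk.mk z_ru L_ru) _ 84 (by decide) (lenOK_of_chunkOK _ _ _ _ _ certD7b_ru_c1) s6
  hv := by
    have s1 : ChunkSem (GramBlk.mk z_rv L_ru) 0 15 [] _ := chunkSem_of_ok _ _ _ _ _ certD7b_rv_c1
    have s2 : ChunkSem (GramBlk.mk z_rv L_ru) 0 30 [] _ := chunkSem_trans (GramBlk.mk z_rv L_ru) 0 15 15 _ _ _ s1 (chunkSem_of_ok _ _ _ _ _ certD7b_rv_c2)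
    have s3 : ChunkSem (GramBlk.mk z_rv L_ru) 0 45 [] _ := chunkSem_trans (GramBlk.mk z_rv L_ru) 0 30 15 _ _ _ s2 (chunkSem_of_ok _ _ _ _ _ certD7b_rv_c3)
    have s4 : ChunkSem (GramBlk.mk z_rv L_ru) 0 60 [] _ := chunkSem_trans (GramBlk.mk z_rv L_ru) 0 45 15 _ _ _ s3 (chunkSem_of_ok _ _ _ _ _ certD7b_rv_c4)
    have s5 : ChunkSem (GramBlk.mk z_rv L_ru) 0 75 [] _ := chunkSem_trans (GramBlk.mk z_rv L_ru) 0 60 15 _ _ _ s4 (chunkSem_of_ok _ _ _ _ _ certD7b_rv_c5)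
    have s6 : ChunkSem (GramBlk.mk z_rv L_ru) 0 84 [] _ := chunkSem_trans (GramBlk.mk z_rv L_ru) 0 75 9 _ _ _ s5 (chunkSem_of_ok _ _ _ _ _ certD7b_rv_c6)
    exact boxNonneg_of_chunkSem' (GramBlk.mk z_rv L_ru) _ 84 (by decide) (lenOK_of_chunkOK _ _ _ _ _ certD7b_rv_c1) s6
  ht := by
    have s1 : ChunkSem (GramBlk.mk z_rt L_ru) 0 15 [] _ := chunkSem_of_ok _ _ _ _ _ certD7b_rt_c1
    have s2 : ChunkSem (GramBlk.mk z_rt L_ru) 0 30 [] _ := chunkSem_trans (GramBlk.mk z_rt L_ru) 0 15 15 _ _ _ s1 (chunkSem_of_ok _ _ _ _ _ certD7b_rt_c2)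
    have s3 : ChunkSem (GramBlk.mk z_rt L_ru) 0 45 [] _ := chunkSem_trans (GramBlk.mk z_rt L_ru) 0 30 15 _ _ _ s2 (chunkSem_of_ok _ _ _ _ _ certD7b_rt_c3)
    have s4 : ChunkSem (GramBlk.mk z_rt L_ru) 0 60 [] _ := chunkSem_trans (GramBlk.mk z_rt L_ru) 0 45 15 _ _ _ s3 (chunkSem_of_ok _ _ _ _ _ certD7b_rt_c4)
    have s5 : ChunkSem (GramBlk.mk z_rt L_ru) 0 75 [] _ := chunkSem_trans (GramBlk.mk z_rt L_ru) 0 60 15 _ _ _ s4 (chunkSem_of_ok _ _ _ _ _ certD7b_rt_c5)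
    have s6 : ChunkSem (GramBlk.mk z_rt L_ru) 0 84 [] _ := chunkSem_trans (GramBlk.mk z_rt L_ru) 0 75 9 _ _ _ s5 (chunkSem_of_ok _ _ _ _ _ certD7b_rt_c6)
    exact boxNonneg_of_chunkSem' (GramBlk.mk z_rt L_ru) _ 84 (by decide) (lenOK_of_chunkOK _ _ _ _ _ certD7b_rt_c1) s6
  h4 := by
    have s1 : ChunkSem (GramBlk.mk z_r4 L_r4) 0 15 [] _ := chunkSem_of_ok _ _ _ _ _ certD7b_r4_c1
    have s2 : ChunkSem (GramBlk.mk z_r4 L_r4) 0 30 [] _ := chunkSem_trans (GramBlk.mk z_r4 L_r4) 0 15 15 _ _ _ s1 (chunkSem_of_ok _ _ _ _ _ certD7b_r4_c2)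
    have s3 : ChunkSem (GramBlk.mk z_r4 L_r4) 0 45 [] _ := chunkSem_trans (GramBlk.mk z_r4 L_r4) 0 30 15 _ _ _ s2 (chunkSem_of_ok _ _ _ _ _ certD7b_r4_c3)
    have s4 : ChunkSem (GramBlk.mk z_r4 L_r4) 0 56 [] _ := chunkSem_trans (GramBlk.mk z_r4 L_r4) 0 45 11 _ _ _ s3 (chunkSem_of_ok _ _ _ _ _ certD7b_r4_c4)
    exact boxNonneg_of_chunkSem' (GramBlk.mk z_r4 L_r4) _ 56 (by decide) (lenOK_of_chunkOK _ _ _ _ _ certD7b_r4_c1) s4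
  hq := by
    have s1 : ChunkSem (GramBlk.mk z_q L_q) 0 8 [] _ := chunkSem_of_ok _ _ _ _ _ certD7b_q_c1
    exact boxNonneg_of_chunkSem' (GramBlk.mk z_q L_q) _ 8 (by decide) (lenOK_of_chunkOK _ _ _ _ _ certD7b_q_c1) s1
  hq1 := by
    have s1 : ChunkSem (GramBlk.mk z_q1 L_q1) 0 7 [] _ := chunkSem_of_ok _ _ _ _ _ certD7b_q1_c1
    exact boxNonneg_of_chunkSem' (GramBlk.mk z_q1 L_q1) _ 7 (by decide) (lenOK_of_chunkOK _ _ _ _ _ certD7b_q1_c1) s1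

/-- **T13(arccos(257/500)) in the kernel**: every finite set of unit vectors of `ℝ³` with pairwise inner products
`≤ 257/500` has at most `12` elements — no 13 points of `S²` are pairwise `≥ arccos(257/500)` apart; by a kernel-checked
Bachoc–Vallentin three-point certificate (n = 3). [cite: BachocVallentin2007, Theorem 4.2] -/
theorem sphereCode_card_le_twelve_257_500 (C : Finset (EuclideanSpace ℝ (Fin 3)))
    (hC : ∀ x ∈ C, ‖x‖ = 1) (hcode : ∀ x ∈ C, ∀ y ∈ C, x ≠ y → inner ℝ x y ≤ (257 : ℝ) / 500) :
    C.card ≤ 12 :=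
  card_le_12_of_cert3 (Cert3.mk (257) (500) 7 40 28 34 certA (4777328529809) (-401464252043) (33737170191) [FBlk.mk 0 certFws0, FBlk.mk 1 certFws1, FBlk.mk 2 certFws2, FBlk.mk 3 certFws3, FBlk.mk 4 certFws4, FBlk.mk 5 certFws5, FBlk.mk 6 certFws6, FBlk.mk 7 certFws7] c0 c01) (CertPolys.mk (ofFlat fFP_0 ++ ofFlat fFP_1 ++ ofFlat fFP_2 ++ ofFlat fFP_3) (ofFlat fR_r_0 ++ ofFlat fR_r_1 ++ ofFlat fR_r_2 ++ ofFlat fR_r_3 ++ ofFlat fR_r_4 ++ ofFlat fR_r_5 ++ ofFlat fR_r_6) (ofFlat fR_ru_0 ++ ofFlat fR_ru_1 ++ ofFlat fR_ru_2 ++ ofFlat fR_ru_3 ++ ofFlat fR_ru_4) (permBAC (ofFlat fR_ru_0 ++ ofFlat fR_ru_1 ++ ofFlat fR_ru_2 ++ ofFlat fR_ru_3 ++ ofFlat fR_ru_4)) (permCBA (ofFlat fR_ru_0 ++ ofFlat fR_ru_1 ++ ofFlat fR_ru_2 ++ ofFlat fR_ru_3 ++ ofFlat fR_ru_4)) (ofFlat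 fR_r4_0 ++ ofFlat fR_r4_1 ++ ofFlat fR_r4_2) (ofFlat fR_q_0) (ofFlat fR_q1_0)) certD7b_polys certD7b_I certD7b_II certD7b_side certD7b_bound (by norm_num) C hC
    (fun x hx y hy hxy => by have h := hcode x hx y hy hxy; push_cast; linarith)

end Summit.Ventures.Crystal3D.TopCut

end
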